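import Mathlib.Analysis.InnerProductSpace.Adjoint
import Mathlib.Analysis.Normed.Operator.Compact.Basic
import HarnessLib

/-!
# Restriction of a bounded operator to a closed invariant subspace

Topic `Literature/Analysis/OperatorTheory` (next to `CompactSelfAdjointBottom.lean`, whose
`exists_rayleigh_eq_of_isGLB_of_neg_of_invariant` performs the same compression inline).
Theorems only (no definition, no named fact, no instance).

Let `H` be a Hilbert space over `𝕜 = ℝ` or `ℂ`, `T : H →L[𝕜] H` a bounded operator and `V ≤ H` a
closed subspace with `T V ⊆ V`.  Then `T` induces a bounded operator `T'` on the Hilbert space `V`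
(the subtype, with the inner product inherited from `H`, `Submodule.coe_inner`), and everything one
computes with `T'` is computed with `T`:

* `(T' v : H) = T v` and, by induction, `((T' ^ n) v : H) = (T ^ n) v` for all `n`;
* matrix elements: `⟪T' v, w⟫ = ⟪T v, w⟫` for `v w ∈ V`;
* if `T` is symmetric (`⟪T x, y⟫ = ⟪x, T y⟫` on `H`) then so is `T'`;
* if `T` is compact then so is `T'` (a compact set `K ⊆ H` absorbing the image of a `0`-neighbourhood
  pulls back to the compact set `V ∩ K` of the closed subspace `V`; Mathlib's
  `IsCompactOperator.restrict`).

This is packaged as ONE existential statement `exists_restrict_invariant` (the operator is Mathlib's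
`ContinuousLinearMap.restrict T hTV`; no new definition is introduced), which is the form in which
spectral statements about operators on a Hilbert space are transported to the compression of `T`
to a closed invariant subspace.

What is NOT here: the orthogonal complement `Vᗮ` (invariant when `T` is symmetric,
`LinearMap.IsSymmetric.orthogonalComplement_mem_invtSubmodule` in Mathlib), and spectra /
eigenvalues of the restriction.

## References

* M. Reed, B. Simon, *Methods of Modern Mathematical Physics I: Functional Analysis* (1980),
  §VI.5 (compact operators; restriction to invariant subspaces is used throughout the proof of the
  Hilbert–Schmidt theorem, Thm. VI.16). Standard; recorded as folklore.
-/

open scoped InnerProductSpace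

namespace Literature.Analysis.OperatorTheory

/-- **Restriction of a bounded operator to a closed invariant subspace.** Let `T` be a bounded
operator on a Hilbert space `H` and `V` a closed subspace with `T V ⊆ V`. Then there is a bounded
operator `T'` on the Hilbert space `V` (Mathlib's `T.restrict`) such that `(T' v : H) = T v`,
`((T' ^ n) v : H) = (T ^ n) v` for every `n : ℕ`, `⟪T' v, w⟫ = ⟪T v, w⟫` for `v w : V`, `T'` is
symmetric whenever `T` is, and `T'` is compact whenever `T` is. [folklore] -/
theorem exists_restrict_invariant : ∀ {𝕜 : Type*} [RCLike 𝕜] {H : Type*} [NormedAddCommGroup H]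
    [InnerProductSpace 𝕜 H] [CompleteSpace H] (T : H →L[𝕜] H) (V : Submodule 𝕜 H),
    IsClosed (V : Set H) → (∀ v ∈ V, T v ∈ V) → ∃ T' : V →L[𝕜] V,
      (∀ v : V, ((T' v : V) : H) = T v) ∧
      (∀ (n : ℕ) (v : V), (((T' ^ n) v : V) : H) = (T ^ n) v) ∧
      (∀ v w : V, ⟪T' v, w⟫_𝕜 = ⟪T (v : H), (w : H)⟫_𝕜) ∧
      ((∀ x y : H, ⟪T x, y⟫_𝕜 = ⟪x, T y⟫_𝕜) → ∀ v w : V, ⟪T' v, w⟫_𝕜 = ⟪v, T' w⟫_𝕜) ∧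
      (IsCompactOperator T → IsCompactOperator T') := by
  intro 𝕜 _ H _ _ _ T V hV hTV
  -- the restriction `T' = T|_V : V →L[𝕜] V` and its defining identity
  have happly : ∀ v : V, ((T.restrict hTV v : V) : H) = T v := fun v => rfl
  -- iterates: `((T'^n) v : H) = (T^n) v`
  have hpow : ∀ (n : ℕ) (v : V), (((T.restrict hTV ^ n) v : V) : H) = (T ^ n) v := by
    intro n
    induction n with
    | zero =>
      intro v
      rw [pow_zero, pow_zero, one_apply_eq_self, one_apply_eq_self]
    | succ n ih =>
      intro v
      rw [pow_succ, pow_succ, mul_apply_eq_comp, mul_apply_eq_comp, ih, happly]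
  -- matrix elements
  have hinner : ∀ v w : V, ⟪T.restrict hTV v, w⟫_𝕜 = ⟪T (v : H), (w : H)⟫_𝕜 := fun v w => by
    rw [Submodule.coe_inner, happly]
  refine ⟨T.restrict hTV, happly, hpow, hinner, fun hsym v w => ?_, fun hT => ?_⟩
  · -- symmetry transports
    rw [hinner, Submodule.coe_inner, happly]
    exact hsym v w
  · -- compactness transports (`V` is closed)
    exact hT.restrict hTV hV

end Literature.Analysis.OperatorTheory
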